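import Summits.BirchSwinnertonDyer.BirchSwinnertonDyer.Theorems.PrintX11aNonSurjEulerHalfOfMu
import Summits.BirchSwinnertonDyer.BirchSwinnertonDyer.Theorems.PrintX11aNonSurjMuAnHardDefs
import Summits.BirchSwinnertonDyer.BirchSwinnertonDyer.Theorems.PrintX11aUpperNonSurjThreeMultDivisibilityAtOfConjA
import Summits.BirchSwinnertonDyer.BirchSwinnertonDyer.Theorems.PrintX11aUpperNonSurjFiveMultTeichDefs
import Summits.BirchSwinnertonDyer.BirchSwinnertonDyer.Theorems.PrintX11aUpperNonSurjFiveOrbitUnitOfMultTeichSpan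
import Summits.BirchSwinnertonDyer.BirchSwinnertonDyer.Theorems.PrintX11aUpperNonSurjFiveMuAnOfOrbitUnit
import Summits.BirchSwinnertonDyer.BirchSwinnertonDyer.Theorems.PrintX11aUpperNonSurjFiveMuRoadGivesConjA
import Summits.BirchSwinnertonDyer.Rank1Residual.GaloisImage.MultiplicativeLargeImage
import Literature.NumberTheory.EllipticCurves.Rank1Residual.MuLambdaCarriers
import Literature.NumberTheory.EllipticCurves.AtkinLehnerInvolutionsProofs
import HarnessLib

/-!
# Route `PrintX11a`, crux U5 `UpperNonSurjFive` (item stmt-BirchSwinnertonDyer-20614) — line «alcut5»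
# (ideator bsd-idea-6 g4, lens «decomp»): the ATKIN–LEHNER SIGN CUT of the μ-road's only open input S1

PUBLISHED ONLY (W-79): the line of record stays «finemu5» r4 (lead bsd-line-x11a-p3); this file is NOT passed to
`ledger skeleton check`.  BSD is not proved by any of this; U5 does NOT close by this file (three open `sorry`s + two
by-name published inputs); nothing is asserted about any curve.

THE CUT.  The line of record closes U5 modulo {S1₅, S1₇, BDMTV, 19949}, S1ₚ = `MultTeich.MultTeichSpanGen M p`: for every
`γ ∈ Γ₁(pM)`, `γ·γ^ι ∈ ⟨packet quotients ∪ trivial ∪ p-th powers⟩·[Γ₀(pM),Γ₀(pM)]`.  S1 is consumed (landed S2,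
`exists_one_le_norm_teichOrbitSum_of_multTeichSpanGen`) through Manin's integer period homomorphism `m_f : Γ₀(pM) → ℤ` of ONE
rational `p`-NEW newform `f`, and `m_f` kills MORE than S1's generators: the Atkin–Lehner matrix `W = w(p) = (px, y; pM·?, p)`
normalises `Γ₀(pM)` and `f ∣ w_p = λ_p f` with `λ_p = −a_p(f) ∈ {±1}` (tree theorems
`IsNewform0.exists_atkinLehnerInvolutionAt_eq_smul_of_not_dvd`, `…atkinLehnerEigenvalueAt_eq_neg_coeff_of_not_dvd`), whence
Manin's `{∞, γ'∞}_f = λ_p {∞, γ∞}_f` for `γ' W = W γ` (landed at `p = 3`: `MultThreeAL.cuspSymbol_eq_mul_of_conj_alWInt`;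
p-generic port announced by the cell's `Theorems.MultOrbit` series).  So `m_f` kills the SIGNED ATKIN–LEHNER TWISTS
`γ'·γ^sg`, `sg = −λ_p = a_p(f)`: `sg = +1` for SPLIT, `sg = −1` for NON-SPLIT multiplicative reduction.  Adding these twists to
S1's generator set gives two statements `ALCutSpanGen M p sg` (`sg = ±1`), EACH implied by S1 (`alCutSpanGen_of_multTeichSpanGen`,
real proof below) and jointly sufficient for U5 (composition `UpperNonSurjFive_of_alcut`, real proof): U5 is cut BY THE SIGN
`a_p = ±1` into two strictly weaker span statements.

WHY THIS CUT (structure, not cosmetics).  Modulo the twists `γ'γ⁻¹` (non-split half) the target group is the abelianisation of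
the p-UNIT GROUP `Γ* = ⟨Γ₀(pM), W⟩ ⊂ PGL₂(ℤ[1/p])` — exactly the group of the cell's Atkin–Lehner-extended orbit trick
(`Theorems/PrintX11aMultOrbitDefs.lean`: `Γ*` is TRANSITIVE on the cusp classes `[∞]∪[1/M]`, `[0]∪[1/p]`, the defect that makes
Theorem B vacuous at level `pM`), an `S`-arithmetic group for which the Vaserstein / Serre generation over `ℤ[1/p]` that PROVED
the un-averaged good-level span (`conjSpanGen_holds`) is available; modulo the anti-twists `γ'γ` (split half) it is the
`sgn_W`-twisted abelianisation of `Γ*`.  On the Bruhat–Tits tree of `PGL₂(ℚ_p)`: `Γ₀(M)[1/p]` fixes nothing, `Γ₀(pM)` is the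
stabiliser of an ORIENTED edge, `Γ*` of the UNORIENTED edge (Ihara: `Γ₀(M)[1/p]⁽¹⁾ = Γ₀(M) *_{Γ₀(pM)} Γ₀(M)^W`); the two halves are the `±`-eigenspaces of edge reversal on
edge-functions, i.e. the cut is the harmonic-cocycle (p-new, Steinberg-at-p) structure made visible at the level of
generators — which S1, a statement about `Γ₀(pM)` alone, cannot see.  The split half (`a_p = +1`, `w_p = −1`) is the
trivial-zero case of the route (always in the hard locus); which U5 pairs fall in which half is the per-pair datum `a_p = ±1`
(cell CLASS-BOARD), not asserted here.  Atkin–Lehner on modular symbols and on oldclasses (`g_i ∣ W_q = ε g_{β−i}`): Cremona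
1992 §2.1, §2.4 (pp. 15, 21–22).

HONEST RESIDUAL.  For a `p`-new irreducible eigen-character each half is still Greenberg's `μ(ω⁰) = 0` on that
Atkin–Lehner sign (the `ω⁰`-versus-`ω²` branch separation at `p = 5`, `ω⁰` versus `ω^{2,4}` at `p = 7`, is untouched): the cut
removes the `W`-wrong-sign classes (old AND new) from what the packets must span, roughly halving the target, and puts the
non-split half on the cusp-transitive group `Γ*`; it does not supply the averaging mechanism.  Stubs: 3 OPEN
(`stub_alCutSpan_five_nonsplit`, `stub_alCutSpan_five_split`, `stub_alCutSpan_seven`), 1 theorem-grade bridge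
(`stub_orbitUnit_of_alCutSpan`, M/L: the p-generic Atkin–Lehner period relation + the landed S2 template), 2 published inputs
BY NAME (`stub_splitCartanImagesBDMTV`, `stub_pubFactsAn` = item 19949).  beyond-print: the span statements are not in print
(nearest: Manin 1972 Thm 1.9; Merel 1994 generators of `H₁(X₀(N))`; the harmonic-cocycle description of p-new forms,
Darmon 2001 §1 / Bertolini–Darmon 2005 §2).
References: [Manin1972] Prop. 1.4, Thm. 1.9; [Knapp1993] Lemma 9.24, Thm. 9.27; [AtkinLehner1970] Thm. 3;
[MazurTateTeitelbaum1986Invent] §I.10, §I.17; [GreenbergLNM1716] Conj. 1.11; [Serre1980Trees] II.1.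
-/

set_option linter.dupNamespace false
set_option autoImplicit false

noncomputable section

open scoped Classical NumberField MatrixGroups ModularForm

open CongruenceSubgroup WeierstrassCurve Field
  Literature.NumberTheory.EllipticCurves
  Literature.NumberTheory.EllipticCurves.ModularForms
  Literature.NumberTheory.EllipticCurves.Rank1Residual
  Literature.NumberTheory.EllipticCurves.Rank1Residual.Typed
  Literature.NumberTheory.EllipticCurves.Wuthrich2014
  Literature.NumberTheory.EllipticCurves.SteinWuthrich2013
  Literature.NumberTheory.EllipticCurves.Greenberg1999
  Literature.NumberTheory.EllipticCurves.Kato2004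
  Summit.BirchSwinnertonDyer.Rank1Residual
  Summit.BirchSwinnertonDyer.Rank1Residual.X11b
  Summit.BirchSwinnertonDyer.BirchSwinnertonDyer

namespace Summit.BirchSwinnertonDyer.BirchSwinnertonDyer.Cruxes.UpperNonSurjFive.ALCut

open Matrix Matrix.SpecialLinearGroup
open Summit.BirchSwinnertonDyer.BirchSwinnertonDyer.Cruxes.UpperNonSurjFive.MultTeich
  Summit.BirchSwinnertonDyer.BirchSwinnertonDyer.Cruxes.AnalyticMuZeroX9

/-! ### §0 The Atkin–Lehner twist generators and the cut span statement (definitions over tree objects) -/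

/-- `γ'` is the `w(p)`-conjugate of `γ` inside `Γ₀(N)`: `γ' · W = W · γ` in `GL₂(ℝ)`, `W = atkinLehnerW N p` (the shape of the
hypothesis of `MultThreeAL.cuspSymbol_eq_mul_of_conj_alW`; `W` normalises `Γ₀(N)` for `p ∥ N`, `atkinLehnerW_mul_mul_inv_mem`).
[cite: Knapp1993, Lemma 9.24] -/
def IsALConj (N p : ℕ) [NeZero p] (γ γ' : Gamma0 N) : Prop :=
  mapGL ℝ (γ' : SL(2, ℤ)) * glCast (atkinLehnerW N p : GL (Fin 2) ℚ) =
    glCast (atkinLehnerW N p : GL (Fin 2) ℚ) * mapGL ℝ (γ : SL(2, ℤ))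

/-- The sign-`sg` Atkin–Lehner twists `γ' · γ^sg` (`γ' = W γ W⁻¹`; `sg : ℤ`, the letter `η` being reserved notation under
`open scoped ModularForm`): under Manin's period homomorphism of a form with `f ∣ w_p = λ f` they go to `(λ + sg)·m(γ)`, so they die
exactly when `sg = −λ = a_p(f)`. [cite: Manin1972, Prop. 1.4] [cite: CremonaAlgorithms1997, §2.1 (p. 15)] -/
def alTwistGens (N p : ℕ) [NeZero p] (sg : ℤ) : Set (Gamma0 N) :=
  {g | ∃ γ γ' : Gamma0 N, IsALConj N p γ γ' ∧ g = γ' * γ ^ sg}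

/-- **The Atkin–Lehner-cut span statement at multiplicative level `pM`, sign `sg`** (`ALCutSpanGen M p sg`): S1's statement with the
sign-`sg` twists added to the generators — for every `γ ∈ Γ₁(pM)`,
`γ·γ^ι ∈ ⟨packet quotients ∪ trivial ∪ p-th powers ∪ AL-twists_sg⟩ · [Γ₀(pM), Γ₀(pM)]`.  Dually: every additive character
`H₁(X₀(pM);ℤ) → 𝔽_p` with `χ ∘ W = −sg·χ` killing the packet-quotient classes has Eisenstein even part.  `sg = −1`: a statement
about `H₁(Γ*; 𝔽_p)`, `Γ* = ⟨Γ₀(pM), W⟩`; `sg = +1`: about the `sgn_W`-twisted `H₁`.  A PREDICATE; nothing asserted.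
[cite: Manin1972, Prop. 1.4] [cite: Knapp1993, Lemma 9.24] -/
def ALCutSpanGen (M p : ℕ) [NeZero p] (sg : ℤ) : Prop :=
  ∀ γ : Gamma0 (p * M), γ ∈ Gamma1' (p * M) →
    γ * TeichSpan.iotaGamma0 γ ∈
      Subgroup.closure (multTeichPacketQuotients (p * M) p ∪ trivialGens (p * M) ∪ pthPowers (p * M) p ∪
          alTwistGens (p * M) p sg) ⊔
        commutator (Gamma0 (p * M))

/-- **Each cut is implied by S1 (real proof)**: enlarging the generator set only enlarges the closure.  So the two cut
statements are (individually) WEAKER than the line of record's `MultTeichSpanGen M p`. [cite: Manin1972, Prop. 1.4] -/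
theorem alCutSpanGen_of_multTeichSpanGen {M p : ℕ} [NeZero p] (sg : ℤ) (h : MultTeichSpanGen M p) :
    ALCutSpanGen M p sg := by
  intro γ hγ
  exact (sup_le_sup_right (Subgroup.closure_mono Set.subset_union_left) _) (h γ hγ)

/-! ### §1 The stubs -/

/-- **stub (OPEN; the non-split half at `p = 5`)**: for every `M` prime to `5`, `ALCutSpanGen M 5 (−1)` — the packets span
`H₁(X₀(5M);𝔽₅)⁺` modulo Eisenstein AND modulo the `w₅`-ANTI-invariant classes, i.e. they span the even part of
`H₁(Γ*;𝔽₅)`, `Γ* = ⟨Γ₀(5M), w₅⟩ ⊂ PGL₂(ℤ[1/5])` (cusp-transitive).  Serves the U5 pairs with NON-SPLIT multiplicative `5`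
(`a₅ = −1`, `λ₅ = +1`).  Why it might fail: for a 5-new irreducible eigen-character with `λ₅ = +1` it is still Greenberg's
`μ(ω⁰) = 0` (branch separation `ω⁰`/`ω²` untouched); census of S1 (true at all 1058 levels, ideator/lead g3) implies it
numerically but a proof needs the averaging mechanism.  [cite: GreenbergLNM1716, Conj. 1.11 (p. 64)] [cite: Manin1972, Thm. 1.9]
[cite: Knapp1993, Lemma 9.24] -/
theorem stub_alCutSpan_five_nonsplit : ∀ M : ℕ, ¬ 5 ∣ M → ALCutSpanGen M 5 (-1) := by
  sorry

/-- **stub (OPEN; the split half at `p = 5`)**: for every `M` prime to `5`, `ALCutSpanGen M 5 1` — the packets span modulo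
Eisenstein and modulo the `w₅`-INVARIANT classes (the `sgn_W`-twisted abelianisation of `Γ*`).  Serves the U5 pairs with SPLIT
multiplicative `5` (`a₅ = +1`, `λ₅ = −1`; the trivial-zero case, always in the hard locus).  Why it might fail: as above on the
`λ₅ = −1` new eigen-characters. [cite: GreenbergLNM1716, Conj. 1.11 (p. 64)] [cite: MazurTateTeitelbaum1986Invent, §I.17]
[cite: Knapp1993, Lemma 9.24] -/
theorem stub_alCutSpan_five_split : ∀ M : ℕ, ¬ 5 ∣ M → ALCutSpanGen M 5 1 := by
  sorry

/-- **stub (OPEN; both signs at `p = 7`, 3 known pairs)**: for every `M` prime to `7` and `sg = ±1`, `ALCutSpanGen M 7 sg`.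
Why it might fail: as above (`ω⁰` versus `ω²,ω⁴`). [cite: GreenbergLNM1716, Conj. 1.11 (p. 64)] [cite: Knapp1993, Lemma 9.24] -/
theorem stub_alCutSpan_seven : ∀ M : ℕ, ¬ 7 ∣ M → ∀ sg : ℤ, (sg = 1 ∨ sg = -1) → ALCutSpanGen M 7 sg := by
  sorry

/-- **stub (BRIDGE; theorem-grade, size M/L; the cut analogue of the LANDED S2
`MultTeich.exists_one_le_norm_teichOrbitSum_of_multTeichSpanGen`)**: at level `pM` (`p ∤ M`, `p` odd) a rational newform `f`
with Atkin–Lehner eigenvalue `−sg` at `p` (`sg = ±1`; for an elliptic curve `sg = a_p`), a non-Eisenstein prime `ℓ ∤ pM`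
(`p ∤ a_ℓ − ℓ − 1`) and the cut statement `ALCutSpanGen M p sg` has a Teichmüller orbit sum of `p`-adic norm `≥ 1`.
Proof plan: (1) p-generic port of `MultThreeAL.cuspSymbol_eq_mul_of_conj_alW` (`γ' W = W γ ⟹ {∞,γ'∞}_f = λ {∞,γ∞}_f`, Manin
Prop. 1.4 + Knapp Lemma 9.24; the `p = 3` file is p-generic in structure, cf. the cell's `Theorems.MultOrbit` series) ⟹ Manin's
integer period hom `m` kills `alTwistGens (pM) p sg` when `λ = −sg`; (2) then VERBATIM the landed S2 proof (`m` kills commutators,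
trivial generators, p-th powers mod `p`, and is `≡` an orbit sum on packet quotients; `exists_mem_one_le_norm_sub_of_spanModBy_of_prime`
gives `γ ∈ Γ₁` with `p ∤ m(γ)`, `m(γγ^ι) = 2m(γ)`).  Why it might fail: only typing friction (the `w_p`-slash normalisation
`atkinLehnerInvolutionAt` vs Manin's `cuspSymbol`), settled at `p = 3`. [cite: Manin1972, Prop. 1.4 and Thm. 1.9]
[cite: Knapp1993, Lemma 9.24, Thm. 9.27] [cite: MazurTateTeitelbaum1986Invent, §I.10 (10.1)] -/
theorem stub_orbitUnit_of_alCutSpan {p : ℕ} [Fact p.Prime] [NeZero p] {M : ℕ} [NeZero (p * M)]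
    {f : CuspForm (Gamma0 (p * M)) 2} (hf : IsNewform0 f) (hQ : coeffField f = ⊥) (hp2 : p ≠ 2) (hpM : ¬ p ∣ M)
    {sg : ℤ} (hsg : sg = 1 ∨ sg = -1) (hw : atkinLehnerInvolutionAt (p * M) 2 p f = (-(sg : ℂ)) • f)
    {ℓ : ℕ} [Fact ℓ.Prime] (hℓN : ¬ ℓ ∣ p * M) {aℓ : ℤ} (haℓ : cuspCoeff f ℓ = aℓ)
    (haℓ1 : ¬ (p : ℤ) ∣ aℓ - (ℓ + 1)) (hB : ALCutSpanGen M p sg) :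
    ∃ n : ℕ, 1 ≤ n ∧ ∃ a : (ZMod (p ^ n))ˣ,
      1 ≤ ‖((teichOrbitSum f p n (a : ZMod (p ^ n)) : ℚ) : ℚ_[p])‖ := by
  sorry

/-- **stub (displayed published input, BY NAME; VERBATIM the line of record)**: Balakrishnan–Dogra–Müller–Tuitman–Vonk 2019
Thm. 1.2 (route `ErratumRoadFive` aside item), feeding only the vacuity lemma `p ≤ 7`.
[cite: BalakrishnanEtAl2019, §1 Thm. 1.2 (arXiv:1711.05846 p. 2)] -/
theorem stub_splitCartanImagesBDMTV : Theses.ErratumRoadFive.SplitCartanImagesBDMTV := by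
  sorry

/-- **stub (shared published inputs, BY NAME = item stmt-BirchSwinnertonDyer-19949; VERBATIM the line of record)**.
[cite: Kato2004Asterisque, §17.13 (pp. 279–280)] -/
theorem stub_pubFactsAn : Theses.ErratumRoadFive.KatoTwinFactsFiveAn := by
  sorry

/-! ### §2 Real proofs: dispatch, the orbit unit from the cut, and the composition concluding U5 BY NAME -/

/-- **VACUITY beyond `p = 7` (real proof, VERBATIM the line of record)**. [cite: BalakrishnanEtAl2019, §1 Thm. 1.2 (arXiv:1711.05846 p. 2)] -/
theorem le_seven_of_classX11a_nonSurj (W : WeierstrassCurve ℚ) [W.IsElliptic] [W.IsGloballyMinimal] (p : ℕ) [Fact p.Prime]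
    (hX : ClassX11a W p) (hns : ¬ Surj W p) : p ≤ 7 := by
  by_cases h5 : 5 ≤ p
  · rcases GaloisImage.eq_five_or_eq_seven_of_mult_of_irr_of_not_surj W p stub_splitCartanImagesBDMTV h5 hX.2.2.1
      hX.2.2.2.1 hns with h | h <;> omega
  · omega

/-- **Dispatch (real proof)**: on the U5 domain, BOTH signed cuts at the prime of the pair follow from the three open stubs.
[cite: Manin1972, Prop. 1.4] -/
theorem alCutSpan_of_classX11a_nonSurj (W : WeierstrassCurve ℚ) [W.IsElliptic] [W.IsGloballyMinimal] (p : ℕ) [Fact p.Prime]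
    [NeZero p] (hX : ClassX11a W p) (hns : ¬ Surj W p) (hp5 : 5 ≤ p) :
    ∀ M : ℕ, ¬ p ∣ M → ∀ sg : ℤ, (sg = 1 ∨ sg = -1) → ALCutSpanGen M p sg := by
  have hp : p.Prime := Fact.out
  have h7 : p ≤ 7 := le_seven_of_classX11a_nonSurj W p hX hns
  intro M hM sg hsg
  interval_cases p
  · rcases hsg with rfl | rfl
    · exact stub_alCutSpan_five_split M hM
    · exact stub_alCutSpan_five_nonsplit M hM
  · exact absurd hp (by decide)
  · exact stub_alCutSpan_seven M hM sg hsg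

/-- **The orbit unit from the cuts (real proof modulo the bridge stub)**: at every U5 pair the prime `p` is odd, the level of
every newform of `W` is `pM` with `p ∤ M` (`IsNewformOf.dvd_level_and_not_sq_dvd_of_multiplicative`), the newform is a
`w_p`-eigenvector with eigenvalue `±1` (`IsNewform0.exists_atkinLehnerInvolutionAt_eq_smul_of_not_dvd`), irreducibility gives a
non-Eisenstein good prime `ℓ`, and the bridge applied to the cut OF THE RIGHT SIGN gives a unit orbit sum.
[cite: Knapp1993, Thm. 9.27] [cite: Manin1972, Thm. 1.9] -/
theorem orbitUnit_of_alCutSpan_at (W : WeierstrassCurve ℚ) [W.IsElliptic] [W.IsGloballyMinimal] (p : ℕ) [Fact p.Prime]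
    [NeZero p] (hp2 : p ≠ 2) (hcut : ∀ M : ℕ, ¬ p ∣ M → ∀ sg : ℤ, (sg = 1 ∨ sg = -1) → ALCutSpanGen M p sg)
    (hmult : Mult W p) (hirr : Irr W p) : MultTeichOrbitUnitAt W p := by
  intro N _ f hf
  obtain ⟨⟨M, hM⟩, hsq, -⟩ := hf.dvd_level_and_not_sq_dvd_of_multiplicative hmult
  subst hM
  have hpM : ¬ p ∣ M := by
    rintro ⟨k, rfl⟩
    exact hsq ⟨k, by ring⟩
  obtain ⟨ℓ, _, -, hgoodℓ, hℓ1⟩ :=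
    exists_prime_not_dvd_frobeniusTrace_sub not_irreducible_of_frobeniusTrace_congr_holds W p hirr
  have hℓN : ¬ ℓ ∣ p * M := not_dvd_level_of_isNewformOf hf hgoodℓ
  obtain ⟨ε, hε, hw⟩ := hf.1.exists_atkinLehnerInvolutionAt_eq_smul_of_not_dvd p rfl hpM
  rcases hε with rfl | rfl
  · -- `λ_p = +1` (non-split): use the cut of sign `sg = −1`
    exact stub_orbitUnit_of_alCutSpan hf.1 hf.coeffField_eq_bot hp2 hpM (sg := -1) (Or.inr rfl)
      (by simpa using hw) hℓN (cuspCoeff_eq_frobeniusTrace_of_isNewformOf_holds hf hgoodℓ) hℓ1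
      (hcut M hpM (-1) (Or.inr rfl))
  · -- `λ_p = −1` (split): use the cut of sign `sg = +1`
    exact stub_orbitUnit_of_alCutSpan hf.1 hf.coeffField_eq_bot hp2 hpM (sg := 1) (Or.inl rfl)
      (by simpa using hw) hℓN (cuspCoeff_eq_frobeniusTrace_of_isNewformOf_holds hf hgoodℓ) hℓ1
      (hcut M hpM 1 (Or.inl rfl))

/-- **Composition — the Atkin–Lehner-cut μ-road concludes the crux BY NAME (real proof)**: the three open cut stubs ⊕ the
bridge ⊕ BDMTV ⊕ 19949 ⟹ `MultTeichOrbitUnitAt` at every U5 pair ⟹ (landed S3 `stub_multMuAn_of_orbitUnit`) `MultMuAnAt` ⟹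
(landed μ-kernel `multDivisibilityAt_of_katoFacts_of_muAn` + door `missingUpperBoundAt_of_classX11a_of_multDivisibilityAt`)
`Theses.PrintX11a.UpperNonSurjFive`.  [cite: MazurTateTeitelbaum1986Invent, §I.10–I.13] [cite: Kato2004Asterisque, §17.13 (pp. 279–280)] -/
theorem UpperNonSurjFive_of_alcut : Theses.PrintX11a.UpperNonSurjFive := by
  obtain ⟨-, -, -, hGZK, hmod, -, hpar, -, hM, -, -, hJs, hJn, hGS, -, -, hne, h12, hnsI, hspI, h15, h18,
    hfine⟩ := stub_pubFactsAn
  intro W _ _ p _ hX hns hp5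
  haveI : NeZero p := ⟨(Fact.out : p.Prime).ne_zero⟩
  have hμ : MultMuAnAt W p :=
    stub_multMuAn_of_orbitUnit hM h18 W p hp5 hX.2.2.1 hX.2.2.2.1
      (orbitUnit_of_alCutSpan_at W p hX.2.1 (alCutSpan_of_classX11a_nonSurj W p hX hns hp5) hX.2.2.1 hX.2.2.2.1)
  exact missingUpperBoundAt_of_classX11a_of_multDivisibilityAt hJs hJn hGZK hmod hpar W p (hGS W p) hX
    (multDivisibilityAt_of_katoFacts_of_muAn hne h12 hnsI hspI h15 h18 hfine W p hX.2.1 hX.2.2.1 hX.2.2.2.1 hns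
      (fun f hf => hμ f hf))

/-- **S1 still closes the cut road (real proof; sanity)**: the line of record's two S1 stubs imply all three cut stubs'
statements, so «alcut5» is a REFINEMENT of «finemu5» r4's μ-road, never a competitor. [cite: Manin1972, Prop. 1.4] -/
theorem alCutSpan_all_of_multTeichSpan {p : ℕ} [NeZero p] (hS1 : ∀ M : ℕ, ¬ p ∣ M → MultTeichSpanGen M p) :
    ∀ M : ℕ, ¬ p ∣ M → ∀ sg : ℤ, (sg = 1 ∨ sg = -1) → ALCutSpanGen M p sg :=
  fun M hM sg _ => alCutSpanGen_of_multTeichSpanGen sg (hS1 M hM)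


/-! ### §3 Hygiene H1 (critic V#30, r2): the same composition with every stub a HYPOTHESIS, so the glue audits sorry-free
(`#print axioms UpperNonSurjFive_of` = no `sorryAx`).  The six hypotheses are the six stub statements verbatim. -/

/-- The three OPEN signed cut statements and the bridge, as Props (verbatim the stub statements). [cite: Manin1972, Prop. 1.4] -/
def CutFiveNonsplit : Prop := ∀ M : ℕ, ¬ 5 ∣ M → ALCutSpanGen M 5 (-1)

/-- [cite: Manin1972, Prop. 1.4] -/
def CutFiveSplit : Prop := ∀ M : ℕ, ¬ 5 ∣ M → ALCutSpanGen M 5 1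

/-- [cite: Manin1972, Prop. 1.4] -/
def CutSeven : Prop := ∀ M : ℕ, ¬ 7 ∣ M → ∀ sg : ℤ, (sg = 1 ∨ sg = -1) → ALCutSpanGen M 7 sg

/-- The bridge statement (verbatim `stub_orbitUnit_of_alCutSpan`). [cite: Manin1972, Prop. 1.4 and Thm. 1.9] -/
def Bridge : Prop :=
  ∀ (p : ℕ) [Fact p.Prime] [NeZero p] (M : ℕ) [NeZero (p * M)] (f : CuspForm (Gamma0 (p * M)) 2),
    IsNewform0 f → coeffField f = ⊥ → p ≠ 2 → ¬ p ∣ M → ∀ sg : ℤ, (sg = 1 ∨ sg = -1) →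
    atkinLehnerInvolutionAt (p * M) 2 p f = (-(sg : ℂ)) • f → ∀ (ℓ : ℕ) [Fact ℓ.Prime], ¬ ℓ ∣ p * M →
    ∀ aℓ : ℤ, cuspCoeff f ℓ = aℓ → ¬ (p : ℤ) ∣ aℓ - (ℓ + 1) → ALCutSpanGen M p sg →
    ∃ n : ℕ, 1 ≤ n ∧ ∃ a : (ZMod (p ^ n))ˣ, 1 ≤ ‖((teichOrbitSum f p n (a : ZMod (p ^ n)) : ℚ) : ℚ_[p])‖

/-- Vacuity beyond `7`, hypothesis-taking. [cite: BalakrishnanEtAl2019, §1 Thm. 1.2 (arXiv:1711.05846 p. 2)] -/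
theorem le_seven_of_classX11a_nonSurj_of (hB : Theses.ErratumRoadFive.SplitCartanImagesBDMTV)
    (W : WeierstrassCurve ℚ) [W.IsElliptic] [W.IsGloballyMinimal] (p : ℕ) [Fact p.Prime]
    (hX : ClassX11a W p) (hns : ¬ Surj W p) : p ≤ 7 := by
  by_cases h5 : 5 ≤ p
  · rcases GaloisImage.eq_five_or_eq_seven_of_mult_of_irr_of_not_surj W p hB h5 hX.2.2.1
      hX.2.2.2.1 hns with h | h <;> omega
  · omega

/-- Dispatch, hypothesis-taking. [cite: Manin1972, Prop. 1.4] -/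
theorem alCutSpan_of_classX11a_nonSurj_of (h5n : CutFiveNonsplit) (h5s : CutFiveSplit) (h7 : CutSeven)
    (hB : Theses.ErratumRoadFive.SplitCartanImagesBDMTV)
    (W : WeierstrassCurve ℚ) [W.IsElliptic] [W.IsGloballyMinimal] (p : ℕ) [Fact p.Prime]
    (hX : ClassX11a W p) (hns : ¬ Surj W p) (hp5 : 5 ≤ p) :
    ∀ M : ℕ, ¬ p ∣ M → ∀ sg : ℤ, (sg = 1 ∨ sg = -1) → ALCutSpanGen M p sg := by
  have hp : p.Prime := Fact.out
  have hle : p ≤ 7 := le_seven_of_classX11a_nonSurj_of hB W p hX hns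
  intro M hM sg hsg
  interval_cases p
  · rcases hsg with rfl | rfl
    · exact h5s M hM
    · exact h5n M hM
  · exact absurd hp (by decide)
  · exact h7 M hM sg hsg

/-- The orbit unit from the cuts, hypothesis-taking in the bridge. [cite: Knapp1993, Thm. 9.27] [cite: Manin1972, Thm. 1.9] -/
theorem orbitUnit_of_alCutSpan_at_of (hbr : Bridge) (W : WeierstrassCurve ℚ) [W.IsElliptic] [W.IsGloballyMinimal]
    (p : ℕ) [Fact p.Prime] [NeZero p] (hp2 : p ≠ 2)
    (hcut : ∀ M : ℕ, ¬ p ∣ M → ∀ sg : ℤ, (sg = 1 ∨ sg = -1) → ALCutSpanGen M p sg)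
    (hmult : Mult W p) (hirr : Irr W p) : MultTeichOrbitUnitAt W p := by
  intro N _ f hf
  obtain ⟨⟨M, hM⟩, hsq, -⟩ := hf.dvd_level_and_not_sq_dvd_of_multiplicative hmult
  subst hM
  have hpM : ¬ p ∣ M := by
    rintro ⟨k, rfl⟩
    exact hsq ⟨k, by ring⟩
  obtain ⟨ℓ, _, -, hgoodℓ, hℓ1⟩ :=
    exists_prime_not_dvd_frobeniusTrace_sub not_irreducible_of_frobeniusTrace_congr_holds W p hirr
  have hℓN : ¬ ℓ ∣ p * M := not_dvd_level_of_isNewformOf hf hgoodℓ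
  obtain ⟨ε, hε, hw⟩ := hf.1.exists_atkinLehnerInvolutionAt_eq_smul_of_not_dvd p rfl hpM
  rcases hε with rfl | rfl
  · exact hbr p M f hf.1 hf.coeffField_eq_bot hp2 hpM (-1) (Or.inr rfl) (by simpa using hw) ℓ hℓN _
      (cuspCoeff_eq_frobeniusTrace_of_isNewformOf_holds hf hgoodℓ) hℓ1 (hcut M hpM (-1) (Or.inr rfl))
  · exact hbr p M f hf.1 hf.coeffField_eq_bot hp2 hpM 1 (Or.inl rfl) (by simpa using hw) ℓ hℓN _
      (cuspCoeff_eq_frobeniusTrace_of_isNewformOf_holds hf hgoodℓ) hℓ1 (hcut M hpM 1 (Or.inl rfl))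

/-- **Composition, hypothesis-taking (H1)** — the six stub statements as hypotheses conclude the crux BY NAME; no `sorry`
reaches this proof term. [cite: MazurTateTeitelbaum1986Invent, §I.10–I.13] [cite: Kato2004Asterisque, §17.13 (pp. 279–280)] -/
theorem UpperNonSurjFive_of (h5n : CutFiveNonsplit) (h5s : CutFiveSplit) (h7 : CutSeven) (hbr : Bridge)
    (hB : Theses.ErratumRoadFive.SplitCartanImagesBDMTV) (hpub : Theses.ErratumRoadFive.KatoTwinFactsFiveAn) :
    Theses.PrintX11a.UpperNonSurjFive := by
  obtain ⟨-, -, -, hGZK, hmod, -, hpar, -, hM, -, -, hJs, hJn, hGS, -, -, hne, h12, hnsI, hspI, h15, h18,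
    hfine⟩ := hpub
  intro W _ _ p _ hX hns hp5
  haveI : NeZero p := ⟨(Fact.out : p.Prime).ne_zero⟩
  have hμ : MultMuAnAt W p :=
    stub_multMuAn_of_orbitUnit hM h18 W p hp5 hX.2.2.1 hX.2.2.2.1
      (orbitUnit_of_alCutSpan_at_of hbr W p hX.2.1
        (alCutSpan_of_classX11a_nonSurj_of h5n h5s h7 hB W p hX hns hp5) hX.2.2.1 hX.2.2.2.1)
  exact missingUpperBoundAt_of_classX11a_of_multDivisibilityAt hJs hJn hGZK hmod hpar W p (hGS W p) hX
    (multDivisibilityAt_of_katoFacts_of_muAn hne h12 hnsI hspI h15 h18 hfine W p hX.2.1 hX.2.2.1 hX.2.2.2.1 hns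
      (fun f hf => hμ f hf))

/-- The stubs instantiate the hypotheses (so `UpperNonSurjFive_of_alcut` = `UpperNonSurjFive_of` on the stubs). -/
example : Theses.PrintX11a.UpperNonSurjFive :=
  UpperNonSurjFive_of stub_alCutSpan_five_nonsplit stub_alCutSpan_five_split stub_alCutSpan_seven
    (fun _ _ _ _ _ _ hf hQ hp2 hpM _ hsg hw _ _ hℓN _ haℓ haℓ1 hB =>
      stub_orbitUnit_of_alCutSpan hf hQ hp2 hpM hsg hw hℓN haℓ haℓ1 hB)
    stub_splitCartanImagesBDMTV stub_pubFactsAn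

end Summit.BirchSwinnertonDyer.BirchSwinnertonDyer.Cruxes.UpperNonSurjFive.ALCut
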